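import Summits.BirchSwinnertonDyer.Rank1Residual.X5.TwoAdicTargetsMultKatoIntSplit
import HarnessLib

/-!
# Door (34-INT-pinch-split⁺): `BSD₂(E)` at a SPLIT multiplicative `2` from the Kato datum AT SLACK ONE
# (`ι(T·g) = 2ϖ·L`, the `Δ > 0` face of T-KATO2-SPMULT) **plus `μ(X(E/ℚ_∞)) = 0`**

Residual programme `b2b-bsdres`, cell bsd-2adic, seat `bsd-2adic-mult` GEN 7 (sub-problem `Rank1Residual`,
O1 class-closure at `p = 2`, multiplicative `2`, `E[2]` irreducible). Companion of
`TwoAdicTargetsMultKatoIntSplit.lean` (door (34-INT-pinch-split), the `Δ < 0` face `ι(T·g) = ϖ·L`).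

## What this file is for

PROOF-KATO2SPLIT (HOME/mult/, Thm. B and §4.7) gives, for `E/ℚ` split multiplicative at `2` with
`ρ_{E,2^∞}` surjective, `X = X(E/ℚ_∞)` torsion and an element `g ∈ char_Λ X` with
`ι(T·g) = c_∞ · ϖ · L`, where `L` is THE split `2`-adic `L`-function of the newform `f` of `E`
(`IsSplitMultPAdicLFunctionOf f 2 L`, normalised by `Ω⁺_f = plusPeriod f`, components included),
`ϖ · Ω_E = Ω⁺_f` (`Ω_E = W.realPeriodRat`, components included, so `ord₂ ϖ ≥ 0` is the usual Néron
certificate `hper₀`) and `c_∞ = #π₀(E(ℝ))` — Kato's Euler system is normalised by ONE real cycle.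
On `Δ < 0` (`c_∞ = 1`) the `λ`-pinch of the companion file closes `BSD₂(E)` at tier 1. On `Δ > 0`
(`c_∞ = 2`) the datum is `ι(T·g) = 2ϖ·L` (mult-2's inline binder `hK1sp` of
`Theorems/ByReductionTypeAtTwoMultUpperHalfKatoIntSplit.lean`, p436133), one factor `2` SHORT of the
main-conjecture prediction, and the pinch cannot decide `μ(X) ∈ {0, 1}`. THIS FILE proves that the
single missing input is `μ(X(E/ℚ_∞)) = 0` (Greenberg's `μ`-conjecture for `E[2]` irreducible, read at
`2`; equivalently the "halved" Kato class of the sharp/`W_K2♯` programme):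

* §1 `charIdeal_eq_span_of_katoUpToOneSplit_selmerPinch_of_mu` (pure algebra + the two analytic
  certificates): from `g ∈ char X`, `ι(T·g) = 2ϖ·L`, an integral `G₀` with `ι G₀ = ϖ·L`, `μ(X) = 0`,
  `λ_an = n + 1`, `μ_an = 0` and the Selmer bound `n ≤ λ(X)`: `g = 2·g₀`, `ι(T·g₀) = ϖ·L` and
  `char_Λ X = (g₀)`. (`T·g = 2·G₀` by injectivity of `ι`; constant terms give `T ∣ G₀`; `μ(X) = 0`
  says `2 ∤ f_X`, so in `f_X · b = 2 · g₀` one has `μ(b) = 1`, `b = 2·b′`, `g₀ = f_X · b′`, and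
  `span_eq_span_iff_mu_le_and_lam_le` closes with `μ(g₀) = 0 ≤ μ(f_X)`, `λ(g₀) = n ≤ λ(X) = λ(f_X)`.)
* §2 the doors `bsdp_two_split_of_katoUpToOnePinch_of_mu` (`BSDp W 2`) and
  `analyticRank_eq_zero_of_finite_selmer_of_katoUpToOneSplitPinch_of_mu` (rank-`0` `2`-converse): the
  tail is the companion's (`missingPPartAt_two_split_of_charIdeal_eq_span`, A236 + Greenberg–Stevens).

Scope of record: the 36 split `Δ > 0` classes with `E[2]` irreducible, `2 ∥ N`, rank `0` and
`λ_an = s₂ + 1 = 3` (kit j252619, block SP-Dpos) — for them `BSD₂(E) ⇐ μ(X(E/ℚ_∞)) = 0` modulo the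
displayed inputs; nothing here asserts `μ = 0`.

References: R. Greenberg, LNM 1716 (1999), §4 pp. 112–113, Conj. 1.11, Prop. 4.14; R. Greenberg,
G. Stevens, Invent. Math. 111 (1993); B. Mazur, J. Tate, J. Teitelbaum, Invent. Math. 84 (1986) §I.10,
§I.14; K. Kato, Astérisque 295 (2004) Thm. 17.4; L. Washington, GTM 83, §13.2;
HOME/mult/PROOF-KATO2SPLIT.md §4.7, ADDENDUM-1 A1.3, ADDENDUM-2 A2.3.
-/

set_option autoImplicit false

noncomputable section

open scoped Classical MatrixGroups ModularForm

open CongruenceSubgroup WeierstrassCurve Literature.NumberTheory.EllipticCurves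
  Literature.NumberTheory.EllipticCurves.ModularForms
  Literature.NumberTheory.EllipticCurves.Wuthrich2014
  Literature.NumberTheory.EllipticCurves.Rank1Residual
  Literature.NumberTheory.EllipticCurves.Rank1Residual.Typed
  Literature.NumberTheory.EllipticCurves.Greenberg1999
  Literature.NumberTheory.Transcendental
  Summit.BirchSwinnertonDyer.Rank1Residual.X1.MuLambda
  Summit.BirchSwinnertonDyer.Rank1Residual.X1.MuPart
  Summit.BirchSwinnertonDyer.Rank1Residual.X1.ParitySqueeze

namespace Summit.BirchSwinnertonDyer.Rank1Residual.X5.O1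

variable (W : WeierstrassCurve ℚ) [W.IsElliptic] [W.IsGloballyMinimal]

/-! ## §1 The Selmer `λ`-pinch at a SPLIT `2` from the datum AT SLACK ONE plus `μ(X) = 0` (pure algebra) -/

/-- **The `λ`-pinch from Kato at slack one, GIVEN `μ(X) = 0` (PROVED; pure algebra plus the two analytic
certificates).** Data: a cyclotomic dual datum `D` with `X` torsion and `μ(X) = 0` (`hμX`), an element
`g ∈ char_Λ X` with `ι(T·g) = 2ϖ·L` (`hι`, the `Δ > 0` face of T-KATO2-SPMULT), an integral `G₀` with
`ι G₀ = ϖ·L` (`hG₀`, INT2-AUTO-sp + `ord₂ ϖ ≥ 0`), certificates `λ(G) = n + 1` (`hlan`) and `μ ≤ 0`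
(`hμan`) for every integral `G` with `ι G = ϖ·L`, and the Selmer bound `n ≤ λ(X)` once `μ(X) = 0`
(`hlow`). Conclusion: there is `g₀ ∈ Λ` with `ι(T·g₀) = ϖ·L` and `char_Λ X = (g₀)` (and `g = 2·g₀`).
Proof: `ι` is injective, so `T·g = 2·G₀`; constant coefficients give `T ∣ G₀ = T·g₀`, `g = 2·g₀`;
`λ(g₀) = n`, `μ(g₀) = 0` from the certificates; `char X = (f_X)`, `g = f_X·b`; `μ(X) = 0` is
`μ(f_X) = 0`, so `μ(b) = μ(2·g₀) = 1`, `b = 2·pfree b`, `g₀ = f_X · pfree b`, and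
`span_eq_span_iff_mu_le_and_lam_le` with `λ(g₀) = n ≤ λ(X) = λ(f_X)`.
[cite: Washington1997, §13.2 (after Thm. 13.12)] [cite: GreenbergVatsal2000, p. 2–4, (1)–(2)] -/
theorem charIdeal_eq_span_of_katoUpToOneSplit_selmerPinch_of_mu
    (hsp : W.HasSplitMultiplicativeReductionAtPrime 2) {n : ℕ}
    (hlan : X2.AnalyticLambdaEq W 2 (n + 1)) (hμan : X2.AnalyticMuLE W 2 0)
    {κ : ZpExtension ℚ 2} {γ : Field.absoluteGaloisGroup ℚ} (hκ : κ.IsCyclotomic)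
    (hγ : κ.IsTopGenerator γ) (hγ' : IsCyclotomicVariable 2 γ)
    {N : ℕ} [NeZero N] {f : CuspForm (Gamma0 N) 2} (hf : IsNewformOf W f) {L : PowerSeries ℚ_[2]}
    (hLf : IsSplitMultPAdicLFunctionOf f 2 L) (D : W.SelmerDualData κ γ) (hX : D.IsTorsion)
    (hμX : D.mu = 0) {ϖ : ℚ} (hϖ : (ϖ : ℝ) * W.realPeriodRat = plusPeriod f) {g : IwasawaAlgebra 2}
    (hι : iwasawaToPowerSeries 2 (PowerSeries.X * g) = PowerSeries.C ((2 * ϖ : ℚ) : ℚ_[2]) * L)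
    (hg : g ∈ D.charIdeal) {G₀ : IwasawaAlgebra 2}
    (hG₀ : iwasawaToPowerSeries 2 G₀ = PowerSeries.C (ϖ : ℚ_[2]) * L)
    (hlow : SelmerLambdaLowerBoundAtTwo W n) :
    ∃ g₀ : IwasawaAlgebra 2,
      iwasawaToPowerSeries 2 (PowerSeries.X * g₀) = PowerSeries.C (ϖ : ℚ_[2]) * L ∧
        D.charIdeal = Ideal.span {g₀} := by
  haveI : Module.Finite (IwasawaAlgebra 2) D.X := D.module_finite_holds hγ
  -- (1) `T·g = 2·G₀` in `Λ`, by injectivity of `ι`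
  have hcast : (PowerSeries.C (((2 * ϖ : ℚ) : ℚ_[2])) : PowerSeries ℚ_[2]) =
      PowerSeries.C (((2 : ℕ) : ℤ_[2]) : ℚ_[2]) * PowerSeries.C ((ϖ : ℚ) : ℚ_[2]) := by
    rw [← map_mul]
    congr 1
  have hιC : iwasawaToPowerSeries 2 (PowerSeries.C ((2 : ℕ) : ℤ_[2])) =
      PowerSeries.C (((2 : ℕ) : ℤ_[2]) : ℚ_[2]) := by
    rw [iwasawaToPowerSeries, PowerSeries.map_C]
    rfl
  have hE : (PowerSeries.X * g : IwasawaAlgebra 2) = PowerSeries.C ((2 : ℕ) : ℤ_[2]) * G₀ := by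
    apply iwasawaToPowerSeries_injective 2
    rw [hι, map_mul, hιC, hG₀, hcast, mul_assoc]
  -- (2) constant coefficients: `T ∣ G₀`
  have h20 : ((2 : ℕ) : ℤ_[2]) ≠ 0 := by norm_num
  have hc0 : PowerSeries.constantCoeff G₀ = 0 := by
    have h := congrArg (fun φ : IwasawaAlgebra 2 => PowerSeries.constantCoeff φ) hE
    simp only [map_mul, PowerSeries.constantCoeff_X, zero_mul, PowerSeries.constantCoeff_C] at h
    rcases mul_eq_zero.mp h.symm with h2 | h2
    · exact absurd h2 h20
    · exact h2
  obtain ⟨g₀, hG₀eq⟩ := PowerSeries.X_dvd_iff.mpr hc0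
  have hgeq : g = PowerSeries.C ((2 : ℕ) : ℤ_[2]) * g₀ := by
    have h2 : (PowerSeries.X * g : IwasawaAlgebra 2) =
        PowerSeries.X * (PowerSeries.C ((2 : ℕ) : ℤ_[2]) * g₀) := by
      rw [hE, hG₀eq]; ring
    exact mul_left_cancel₀ PowerSeries.X_ne_zero h2
  have hι₀ : iwasawaToPowerSeries 2 (PowerSeries.X * g₀) = PowerSeries.C (ϖ : ℚ_[2]) * L := by
    rw [← hG₀eq]; exact hG₀
  refine ⟨g₀, hι₀, ?_⟩
  -- (3) the certificates: `μ(g₀) = 0`, `λ(g₀) = n`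
  obtain ⟨k, hk⟩ := hμan f hf ϖ hϖ L (fun _ => hLf) (fun hns => absurd hsp hns)
  rw [← hι₀] at hk
  have hμL₀ : mu (PowerSeries.X * g₀ : IwasawaAlgebra 2) = 0 :=
    Nat.le_zero.mp (mu_le_of_lt_norm_coeff hk)
  have hL₀0 : (PowerSeries.X * g₀ : IwasawaAlgebra 2) ≠ 0 := by
    intro h0
    rw [h0, map_zero, map_zero, norm_zero] at hk
    exact not_le.mpr hk (by positivity)
  have hX0 : (PowerSeries.X : IwasawaAlgebra 2) ≠ 0 := PowerSeries.X_ne_zero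
  have hg₀0 : g₀ ≠ 0 := by
    rintro rfl
    exact hL₀0 (mul_zero _)
  have hlan' : lam (PowerSeries.X * g₀ : IwasawaAlgebra 2) = n + 1 :=
    hlan f hf ϖ hϖ L (fun _ => hLf) (fun hns => absurd hsp hns) _ hι₀
  have hlamg : lam g₀ = n := by
    rw [lam_mul hX0 hg₀0, X2.lam_X] at hlan'
    omega
  have hμg : mu g₀ = 0 := by
    rw [mu_mul hX0 hg₀0, X2.mu_X_eq_zero_and_pfree_X.1] at hμL₀
    omega
  -- (4) `char X = (f_X)`, `μ(f_X) = μ(X) = 0`, `λ(f_X) = λ(X)`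
  haveI : (Module.charIdeal (IwasawaAlgebra 2) D.X).IsPrincipal := charIdeal_isPrincipal_holds 2 D.X
  obtain ⟨fX, hfX⟩ := Submodule.IsPrincipal.principal (Module.charIdeal (IwasawaAlgebra 2) D.X)
  have hchar : D.charIdeal = Ideal.span {fX} := hfX
  have hfX0 : fX ≠ 0 := by
    intro h0
    refine Module.charIdeal_ne_bot (IwasawaAlgebra 2) D.X ?_
    change D.charIdeal = ⊥
    rw [hchar, h0]
    exact Ideal.span_singleton_eq_bot.mpr rfl
  rw [hchar] at hg
  obtain ⟨b, hb⟩ := Ideal.mem_span_singleton'.mp hg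
  have hfac : g = fX * b := by rw [mul_comm, hb]
  have hg0 : g ≠ 0 := by
    rw [hgeq]
    exact mul_ne_zero (by rw [← pow_one ((2 : ℕ) : ℤ_[2])]; exact C_pow_ne_zero 1) hg₀0
  have hb0 : b ≠ 0 := by rintro rfl; exact hg0 (by rw [hfac, mul_zero])
  have hμfX : mu fX = 0 := by
    rw [mu_generator_eq_muInvariant D.X hX hfX0 hchar]
    exact hμX
  have hlamfX : lam fX = D.lambda := lam_generator_eq_lambdaInvariant D.X hX hfX0 hchar
  -- (5) `μ(b) = 1`, so `b = 2·pfree b` and `g₀ = f_X · pfree b`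
  have hred : red g₀ ≠ 0 := by
    intro h0
    have hdvd : PowerSeries.C (((2 : ℕ) : ℤ_[2]) ^ 1) ∣ g₀ := by
      rw [pow_one]; exact (red_eq_zero_iff g₀).mp h0
    have := le_mu_of_C_pow_dvd hg₀0 hdvd
    omega
  have hμ2g₀ : mu (PowerSeries.C ((2 : ℕ) : ℤ_[2]) * g₀ : IwasawaAlgebra 2) = 1 :=
    (mu_eq_and_pfree_eq (a := 1) hred (by rw [pow_one])).1
  have hμb : mu b = 1 := by
    have h := mu_mul hfX0 hb0
    rw [← hfac, hgeq, hμ2g₀, hμfX, zero_add] at h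
    exact h.symm
  have hbeq : b = PowerSeries.C ((2 : ℕ) : ℤ_[2]) * pfree b := by
    have h := eq_C_pow_mu_mul_pfree b
    rwa [hμb, pow_one] at h
  have hfac' : g₀ = fX * pfree b := by
    have h : PowerSeries.C ((2 : ℕ) : ℤ_[2]) * g₀ = PowerSeries.C ((2 : ℕ) : ℤ_[2]) * (fX * pfree b) := by
      rw [← hgeq, hfac]
      conv_lhs => rw [hbeq]
      ring
    exact mul_left_cancel₀ (by rw [← pow_one ((2 : ℕ) : ℤ_[2])]; exact C_pow_ne_zero 1) h
  -- (6) the squeeze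
  have hle : n ≤ D.lambda := hlow κ γ hκ hγ hγ' D hX hμX
  have hspan : Ideal.span ({g₀} : Set (IwasawaAlgebra 2)) = Ideal.span {fX} :=
    (span_eq_span_iff_mu_le_and_lam_le hfX0 hg₀0 hfac').mpr
      ⟨by rw [hμg]; exact Nat.zero_le _, by rw [hlamg, hlamfX]; exact hle⟩
  rw [hspan]
  exact hchar

/-! ## §2 Door (34-INT-pinch-split⁺): `BSD₂(E)` and the rank-`0` `2`-converse from the slack-one datum plus `μ(X) = 0` -/

/-- **DOOR (34-INT-pinch-split⁺), split `E` with `E[2]` irreducible, `Δ(E) > 0` allowed (PROVED modulo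
the displayed inputs): `BSDp W 2`, both halves.** Binders: PRINT {A236 `h41` (Greenberg's split analogue
of Thm. 4.1 at `2`, audit V3 PASS), modularity `hmod`, GZK}; the tree's named fact `greenberg_stevens W 2`
(`hGS`; memo PROOF-GS2); MEMO {the Kato datum AT SLACK ONE `hK1sp` — `X` torsion and `g ∈ char X` with
`ι(T·g) = 2ϖ·L` for THE split `L` (PROOF-KATO2SPLIT Thm. B, `Δ > 0` face; the same inline binder as
mult-2's `Theorems.missingUpperBoundAt_two_split_of_katoUpToOne_of_even`), the Selmer `λ`-lower-bound
`hlow` (PROOF-KATO2MULT §6.2)}; the HYPOTHESIS `hμX : μ(X(E/ℚ_∞)) = 0` for every cyclotomic dual datum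
with `X` torsion (Greenberg's `μ`-conjecture for `E[2]` irreducible read at `2` — NOT asserted, not
discharged here; it is exactly the factor `2 = c_∞` by which the slack-one datum misses the main
conjecture); CERTIFICATES {`λ_an(E) = n + 1` (`hlan`), `μ_an(E) = 0` (`hμan`), the Néron period
certificate `hper₀ : 0 ≤ ord₂ ϖ`}; the curve's decidable data {`Mult W 2`, split}; analytic rank `0`.
Chain: INT2-AUTO-sp (`exists_iwasawaToPowerSeries_eq_of_isSplitMultPAdicLFunctionOf_two`) + `hper₀` ⇒
an integral `G₀` with `ι G₀ = ϖ·L`; §1 ⇒ `char X = (g₀)`, `ι(T·g₀) = ϖ·L`;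
`missingPPartAt_two_split_of_charIdeal_eq_span` ⇒ `ord₂ #Ш_an = ord₂ #Ш`; `bsdp_of_missingPPartAt`.
[cite: GreenbergLNM1716, §4 pp. 112–113 (split l_v), Conj. 1.11 and Prop. 4.14 (p. 124)]
[cite: MazurTateTeitelbaum1986Invent, §I.10, §I.14–15 and §II] [cite: Miller2011LMS, Def. 1.1 and §1] -/
theorem bsdp_two_split_of_katoUpToOnePinch_of_mu {n : ℕ}
    (h41 : thm41Analogue_charValue_rankZero_split_baseChange_anyPrime)
    (hGS : greenberg_stevens (W := W) (p := 2))
    (hmod : nonempty_modularParametrizationData)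
    (hGZK : rank_eq_analyticRank_of_analyticRank_le_one)
    (hK1sp : ∀ (κ : ZpExtension ℚ 2) (γ : Field.absoluteGaloisGroup ℚ), κ.IsCyclotomic →
      κ.IsTopGenerator γ → IsCyclotomicVariable 2 γ →
      ∀ [NeZero (W.conductorNorm ℤ)] (f : CuspForm (Gamma0 (W.conductorNorm ℤ)) 2), IsNewformOf W f →
      ∀ ϖ : ℚ, (ϖ : ℝ) * W.realPeriodRat = plusPeriod f →
      ∀ L : PowerSeries ℚ_[2], IsSplitMultPAdicLFunctionOf f 2 L → ∀ D : W.SelmerDualData κ γ,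
        D.IsTorsion ∧ ∃ g ∈ D.charIdeal,
          iwasawaToPowerSeries 2 (PowerSeries.X * g) = PowerSeries.C ((2 * ϖ : ℚ) : ℚ_[2]) * L)
    (hμX : ∀ (κ : ZpExtension ℚ 2) (γ : Field.absoluteGaloisGroup ℚ), κ.IsCyclotomic →
      κ.IsTopGenerator γ → IsCyclotomicVariable 2 γ → ∀ D : W.SelmerDualData κ γ, D.IsTorsion → D.mu = 0)
    (hlow : SelmerLambdaLowerBoundAtTwo W n)
    (hper₀ : ∀ [NeZero (W.conductorNorm ℤ)] (f : CuspForm (Gamma0 (W.conductorNorm ℤ)) 2),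
      IsNewformOf W f → ∀ ϖ : ℚ, (ϖ : ℝ) * W.realPeriodRat = plusPeriod f → 0 ≤ padicValRat 2 ϖ)
    (hr : W.analyticRank = 0) (hmult : Mult W 2) (hsp : W.HasSplitMultiplicativeReductionAtPrime 2)
    (hlan : X2.AnalyticLambdaEq W 2 (n + 1)) (hμan : X2.AnalyticMuLE W 2 0) : BSDp W 2 := by
  haveI : NeZero (W.conductorNorm ℤ) := ⟨(W.conductorNorm_pos_holds).ne'⟩
  obtain ⟨Dm⟩ := hmod W
  have hf : IsNewformOf W Dm.f := Dm.isNewformOf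
  have hL : W.entireLFunction 1 ≠ 0 :=
    (W.analyticRank_eq_zero_iff_holds hf.hasEntireLFunction).mp hr
  obtain ⟨ϖ, -, hϖ, -⟩ := Dm.exists_rat_mul_realPeriodRat_eq_plusPeriod
  obtain ⟨κ, hκ, γ, hγ, hγ'⟩ := exists_isCyclotomic_isTopGenerator_isCyclotomicVariable_holds 2
  obtain ⟨DW⟩ := W.nonempty_selmerDualData_holds κ γ hγ
  obtain ⟨L, hLf⟩ := exists_isSplitMultPAdicLFunctionOf hsp hf
  obtain ⟨hX, g, hg, hι⟩ := hK1sp κ γ hκ hγ hγ' Dm.f hf ϖ hϖ L hLf DW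
  -- the integral `G₀` with `ι G₀ = ϖ·L` (INT2-AUTO-sp and `ord₂ ϖ ≥ 0`)
  obtain ⟨L₀, hL₀⟩ := exists_iwasawaToPowerSeries_eq_of_isSplitMultPAdicLFunctionOf_two hsp hf hLf
  have hϖnorm : ‖((ϖ : ℚ) : ℚ_[2])‖ ≤ 1 := by
    have h := hper₀ Dm.f hf ϖ hϖ
    by_cases h0 : ϖ = 0
    · subst h0; simp
    have hϖQ : ((ϖ : ℚ) : ℚ_[2]) ≠ 0 := by exact_mod_cast h0
    rw [Padic.norm_eq_zpow_neg_valuation hϖQ, Padic.valuation_ratCast]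
    exact zpow_le_one_of_nonpos₀ (by norm_num) (by linarith)
  let ϖ₀ : ℤ_[2] := ⟨((ϖ : ℚ) : ℚ_[2]), hϖnorm⟩
  have hG₀ : iwasawaToPowerSeries 2 ((PowerSeries.C ϖ₀ : IwasawaAlgebra 2) * L₀) =
      PowerSeries.C (ϖ : ℚ_[2]) * L := by
    rw [map_mul, hL₀, iwasawaToPowerSeries, PowerSeries.map_C]
    rfl
  obtain ⟨g₀, hι₀, hchar⟩ := charIdeal_eq_span_of_katoUpToOneSplit_selmerPinch_of_mu W hsp hlan hμan
    hκ hγ hγ' hf hLf DW hX (hμX κ γ hκ hγ hγ' DW hX) hϖ hι hg hG₀ hlow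
  exact bsdp_of_missingPPartAt W 2 hGZK (by rw [hr]; exact zero_le_one)
    (missingPPartAt_two_split_of_charIdeal_eq_span W
      (twoAdicEulerCharRankZeroSplitMult_zero_of_greenberg W h41) hGS hGZK hmult hsp hL hκ hγ hγ' hf
      hLf DW hX hϖ hι₀ hchar)

/-- **DOOR (34-INT-pinch-split⁺), CONVERSE FORM (PROVED modulo the displayed inputs):** with the same
inputs MINUS analytic rank `0` and GZK, `Sel_{2^∞}(E/ℚ)` finite ⇒ `L(E,1) ≠ 0 ∧ r_an(E) = 0`.
[cite: GreenbergLNM1716, §4 pp. 112–113, Conj. 1.11 and Prop. 4.14 (p. 124)]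
[cite: MazurTateTeitelbaum1986Invent, §I.14–15 and §II] -/
theorem analyticRank_eq_zero_of_finite_selmer_of_katoUpToOneSplitPinch_of_mu {n : ℕ}
    (h41 : thm41Analogue_charValue_rankZero_split_baseChange_anyPrime)
    (hGS : greenberg_stevens (W := W) (p := 2))
    (hmod : nonempty_modularParametrizationData)
    (hK1sp : ∀ (κ : ZpExtension ℚ 2) (γ : Field.absoluteGaloisGroup ℚ), κ.IsCyclotomic →
      κ.IsTopGenerator γ → IsCyclotomicVariable 2 γ →
      ∀ [NeZero (W.conductorNorm ℤ)] (f : CuspForm (Gamma0 (W.conductorNorm ℤ)) 2), IsNewformOf W f →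
      ∀ ϖ : ℚ, (ϖ : ℝ) * W.realPeriodRat = plusPeriod f →
      ∀ L : PowerSeries ℚ_[2], IsSplitMultPAdicLFunctionOf f 2 L → ∀ D : W.SelmerDualData κ γ,
        D.IsTorsion ∧ ∃ g ∈ D.charIdeal,
          iwasawaToPowerSeries 2 (PowerSeries.X * g) = PowerSeries.C ((2 * ϖ : ℚ) : ℚ_[2]) * L)
    (hμX : ∀ (κ : ZpExtension ℚ 2) (γ : Field.absoluteGaloisGroup ℚ), κ.IsCyclotomic →
      κ.IsTopGenerator γ → IsCyclotomicVariable 2 γ → ∀ D : W.SelmerDualData κ γ, D.IsTorsion → D.mu = 0)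
    (hlow : SelmerLambdaLowerBoundAtTwo W n)
    (hper₀ : ∀ [NeZero (W.conductorNorm ℤ)] (f : CuspForm (Gamma0 (W.conductorNorm ℤ)) 2),
      IsNewformOf W f → ∀ ϖ : ℚ, (ϖ : ℝ) * W.realPeriodRat = plusPeriod f → 0 ≤ padicValRat 2 ϖ)
    (hmult : Mult W 2) (hsp : W.HasSplitMultiplicativeReductionAtPrime 2)
    (hlan : X2.AnalyticLambdaEq W 2 (n + 1)) (hμan : X2.AnalyticMuLE W 2 0)
    (hfin : Finite (W.selmerGroupPInfty 2)) : W.entireLFunction 1 ≠ 0 ∧ W.analyticRank = 0 := by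
  haveI : NeZero (W.conductorNorm ℤ) := ⟨(W.conductorNorm_pos_holds).ne'⟩
  obtain ⟨Dm⟩ := hmod W
  have hf : IsNewformOf W Dm.f := Dm.isNewformOf
  obtain ⟨ϖ, -, hϖ, -⟩ := Dm.exists_rat_mul_realPeriodRat_eq_plusPeriod
  obtain ⟨κ, hκ, γ, hγ, hγ'⟩ := exists_isCyclotomic_isTopGenerator_isCyclotomicVariable_holds 2
  obtain ⟨DW⟩ := W.nonempty_selmerDualData_holds κ γ hγ
  obtain ⟨L, hLf⟩ := exists_isSplitMultPAdicLFunctionOf hsp hf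
  obtain ⟨hX, g, hg, hι⟩ := hK1sp κ γ hκ hγ hγ' Dm.f hf ϖ hϖ L hLf DW
  obtain ⟨L₀, hL₀⟩ := exists_iwasawaToPowerSeries_eq_of_isSplitMultPAdicLFunctionOf_two hsp hf hLf
  have hϖnorm : ‖((ϖ : ℚ) : ℚ_[2])‖ ≤ 1 := by
    have h := hper₀ Dm.f hf ϖ hϖ
    by_cases h0 : ϖ = 0
    · subst h0; simp
    have hϖQ : ((ϖ : ℚ) : ℚ_[2]) ≠ 0 := by exact_mod_cast h0
    rw [Padic.norm_eq_zpow_neg_valuation hϖQ, Padic.valuation_ratCast]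
    exact zpow_le_one_of_nonpos₀ (by norm_num) (by linarith)
  let ϖ₀ : ℤ_[2] := ⟨((ϖ : ℚ) : ℚ_[2]), hϖnorm⟩
  have hG₀ : iwasawaToPowerSeries 2 ((PowerSeries.C ϖ₀ : IwasawaAlgebra 2) * L₀) =
      PowerSeries.C (ϖ : ℚ_[2]) * L := by
    rw [map_mul, hL₀, iwasawaToPowerSeries, PowerSeries.map_C]
    rfl
  obtain ⟨g₀, hι₀, hchar⟩ := charIdeal_eq_span_of_katoUpToOneSplit_selmerPinch_of_mu W hsp hlan hμan
    hκ hγ hγ' hf hLf DW hX (hμX κ γ hκ hγ hγ' DW hX) hϖ hι hg hG₀ hlow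
  exact entireLFunction_one_ne_zero_of_finite_selmer_of_charIdeal_eq_span_split W
    (twoAdicEulerCharRankZeroSplitMult_zero_of_greenberg W h41) hGS hmult hsp hκ hγ hγ' hf hLf DW hX
    hι₀ hchar hfin

end Summit.BirchSwinnertonDyer.Rank1Residual.X5.O1

end
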